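import Mathlib
import HarnessLib
import Summits.NavierStokesRegularity.FluidComputer.TriggeredTransferH1Junction
import Summits.NavierStokesRegularity.FluidComputer.PalasekTowerForceBudget
import Literature.Analysis.FluidPDE.NSEnstrophyPersistenceForced

/-!
# Fluid computer, door N1-FC, DOOR v2 — module C: the `H¹` class PERSISTS along a step
# («v2 adds no demand», Tao 2013 Cor. 11.1 with force)

Cell `ns-blowup`, seat `ns-blowup-fc-prover-2` (g5); companion of `TriggeredTransferH1.lean` /
`TriggeredTransferH1Junction.lean` (door v2, fc-route g3 RULING, ns-blowup STATUS l.3869). LABEL: E–C typing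
hygiene / calculus. WHAT THIS IS NOT: not Navier–Stokes evidence — regularity bookkeeping for ONE classical
solution of the forced system taken as a HYPOTHESIS (a v2 link); no scheme instance, transfer or blow-up is
asserted.

**The point.** The ruling replaced v1's alphabet clause (Fefferman-(4) rapid decay of every level state —
a demand the dynamics does NOT propagate to a hand-over slice `u T`, `T > 0`) by the `H¹` class «smooth,
divergence free, `L²`, `∇ ∈ L²`», with the claim that this class «removes the codimension-∞ demand and adds
none». This module makes the second half a kernel fact: along ANY v2 step at viscosity `ν > 0` from a
level member (`U ≥ U⋆`, so the datum is in the class), EVERY slice `u t`, `t ∈ [0, T + δ]`, is again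
smooth, divergence free, `L²` with `L²` gradient (`TriggerSchemeH1.Link.regular_slice`). Hence the
hand-over clause `u T = zoom λ x₀ w'`, `w' ∈ F U'` asks of the dynamics NOTHING about regularity or decay:
its only content is DESIGN MEMBERSHIP of the unzoomed slice (`Link.handover_content`).

**Proof.** A trigger (smooth on `ℝ × ℝ³`, zero for `t ≥ T` and off the nest ball, all derivatives
bounded) is a Clay-class force — smooth on the half-space with Fefferman's space-time decay (5) — by the
tree's `PalasekTowerForceBudget.clayForce_of_summable_levels` applied to a one-member family
(`clayForce_of_bounded_support`, `TriggerSchemeH1.IsTrigger.clayForce`); a finite-energy classical solution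
of the system forced by a Clay-class force has finite dissipation and finite total speed
(`dissipation_lt_top_of_clayForce`, `totalSpeed_lt_top_of_clayForce`, seats lean/lean2), so from an `H¹`
datum it lies in Tao's `X¹` (`memSobolevX_one_forced_of_totalSpeed`, Cor. 11.1 WITH force — a THEOREM of
the tree, no named fact), whose `L^∞_t H¹_x` half is the slice bound (`memSobolevX_one_of_clayForce_H1`,
`memLp_two_fderiv_slice_of_clayForce_H1`).

References: T. Tao, Anal. PDE 6 (2013) 25–107, Cor. 11.1, Lemma 8.1, Prop. 9.1 [cite: Tao2011, Cor. 11.1];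
C. L. Fefferman, Clay problem description, (5) [cite: FeffermanClay2006, (C) (5)]; T. Tao, J. Amer. Math.
Soc. 29 (2016) §1.3 [cite: Tao2016AveragedNS, §1.3].

0 sorry; axioms ⊆ {propext, Classical.choice, Quot.sound}.
-/

noncomputable section

namespace Summit.NavierStokesRegularity.FluidComputer.TriggeredTransfer

open Set MeasureTheory Function Module
open scoped ENNReal ContDiff NNReal
open Literature.Analysis.FluidPDE
open Literature.Analysis.FluidPDE.FluidComputer (E3 Vel)
open Summit.NavierStokesRegularity.NavierStokesRegularity.Theorems

/-! ## §1 A trigger is a Clay-class force -/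

/-- **A smooth space-time field with bounded derivatives, vanishing for `t ≥ T` and off a ball, is a
Clay-class force**: smooth on the closed half-space `[0, ∞) × ℝ³`, with Fefferman's space-time decay (5),
and silent from `T` on — the one-member case of `PalasekTowerForceBudget.clayForce_of_summable_levels`.
[cite: FeffermanClay2006, (C) (5)] -/
theorem clayForce_of_bounded_support {g : ℝ → Vel} {T R : ℝ} {B : ℕ → ℝ}
    (hs : ContDiff ℝ ∞ (uncurry g)) (hlate : ∀ t, T ≤ t → g t = 0)
    (hfar : ∀ (t : ℝ) (x : E3), R ≤ ‖x‖ → g t x = 0)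
    (hbd : ∀ (i : ℕ) (z : ℝ × E3), ‖iteratedFDeriv ℝ i (uncurry g) z‖ ≤ B i) :
    IsSmoothOnHalfSpace g ∧ HasRapidSpaceTimeDecay g := by
  -- the one-member family
  set G : ℕ → ℝ × E3 → E3 := fun k => if k = 0 then uncurry g else 0 with hG
  have hG0 : G 0 = uncurry g := by simp [hG]
  have hGk : ∀ k, k ≠ 0 → G k = 0 := fun k hk => by simp [hG, hk]
  have hsumG : (fun t x => ∑' k, G k (t, x)) = g := by
    funext t x
    rw [tsum_eq_single 0 (fun k hk => by rw [hGk k hk]; rfl), hG0]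
    rfl
  have h := PalasekTowerForceBudget.clayForce_of_summable_levels G T R
    (fun k => by
      rcases eq_or_ne k 0 with rfl | hk
      · rw [hG0]; exact hs
      · rw [hGk k hk]; exact contDiff_const)
    (fun k z hz => by
      rcases eq_or_ne k 0 with rfl | hk
      · rw [hG0]; change g z.1 z.2 = 0; rw [hlate z.1 hz]; rfl
      · rw [hGk k hk]; rfl)
    (fun k z hz => by
      rcases eq_or_ne k 0 with rfl | hk
      · rw [hG0]; exact hfar z.1 z.2 hz
      · rw [hGk k hk]; rfl)
    (fun m => ⟨fun k => if k = 0 then B m else 0, (hasSum_ite_eq 0 (B m)).summable, fun k z => by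
      rcases eq_or_ne k 0 with rfl | hk
      · show ‖iteratedFDeriv ℝ m (G 0) z‖ ≤ (if (0 : ℕ) = 0 then B m else 0)
        rw [hG0, if_pos rfl]; exact hbd m z
      · show ‖iteratedFDeriv ℝ m (G k) z‖ ≤ (if k = 0 then B m else 0)
        rw [hGk k hk, if_neg hk]
        simp⟩)
  rw [hsumG] at h
  exact ⟨h.1, h.2.1⟩

/-- **A v2 trigger is a Clay-class force** (smooth on the half-space, space-time decay (5)).
[cite: FeffermanClay2006, (C) (5)] -/
theorem TriggerSchemeH1.IsTrigger.clayForce {𝒮 : TriggerSchemeH1} {ε δ T : ℝ} {g : ℝ → Vel}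
    (hg : 𝒮.IsTrigger ε δ T g) : IsSmoothOnHalfSpace g ∧ HasRapidSpaceTimeDecay g :=
  clayForce_of_bounded_support (B := fun i => ε * 𝒮.A i) hg.smooth hg.off_late hg.off_far hg.small

/-- **A v1 trigger is a Clay-class force** (same statement for `TriggerScheme`).
[cite: FeffermanClay2006, (C) (5)] -/
theorem TriggerScheme.IsTrigger.clayForce {𝒮 : TriggerScheme} {ε δ T : ℝ} {g : ℝ → Vel}
    (hg : 𝒮.IsTrigger ε δ T g) : IsSmoothOnHalfSpace g ∧ HasRapidSpaceTimeDecay g :=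
  clayForce_of_bounded_support (B := fun i => ε * 𝒮.A i) hg.smooth hg.off_late hg.off_far hg.small

/-! ## §2 `H¹` persists along a finite-energy classical solution with a Clay-class force -/

/-- `‖D¹w‖` and `‖∇w‖` have the same `L²` mass (`norm_iteratedFDeriv_one`). [folklore] -/
theorem lintegral_enorm_iteratedFDeriv_one_sq (w : Vel) :
    ∫⁻ x, ‖iteratedFDeriv ℝ 1 w x‖ₑ ^ 2 = ∫⁻ x, ‖fderiv ℝ w x‖ₑ ^ 2 :=
  lintegral_congr fun x => by rw [← ofReal_norm, ← ofReal_norm, norm_iteratedFDeriv_one]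

/-- **Tao 2013 Cor. 11.1 WITH a Clay-class force, from an `H¹` datum**: a finite-energy classical
solution of the forced system on `[0, T] × ℝ³` (`ν > 0`), whose force is smooth on the half-space with
the space-time decay (5) and whose datum has `∇u(0) ∈ L²`, lies in `X¹([0,T] × ℝ³)` — finite dissipation
and finite total speed come for free from the Clay force (`dissipation_lt_top_of_clayForce`,
`totalSpeed_lt_top_of_clayForce`), then `memSobolevX_one_forced_of_totalSpeed`. All tree theorems; no
named fact. [cite: Tao2011, Cor. 11.1] -/
theorem memSobolevX_one_of_clayForce_H1 {ν T : ℝ} (hν : 0 < ν) (hT : 0 < T) {f u : ℝ → Vel}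
    {p : ℝ → E3 → ℝ} (hsol : IsClassicalNSSolutionOn (Icc 0 T) ν f u p)
    (hfs : IsSmoothOnHalfSpace f) (hfd : HasRapidSpaceTimeDecay f)
    (hE : ∃ C : ℝ≥0∞, C < ⊤ ∧ ∀ t ∈ Icc 0 T, ∫⁻ x, ‖u t x‖ₑ ^ 2 ≤ C)
    (hH1 : MemLp (fderiv ℝ (u 0)) 2 volume) : MemSobolevX 1 T u := by
  -- the force: all orders, uniformly on the slab
  have hf' : ∀ j ≤ 1, ∃ C : ℝ≥0, ∀ t ∈ Icc 0 T, ∫⁻ x, ‖iteratedFDeriv ℝ j (f t) x‖ₑ ^ 2 ≤ C :=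
    fun j _ => by
      obtain ⟨C, hC⟩ := hfd.exists_lintegral_iteratedFDeriv_slice_sq_le_all (μ := volume) hfs j
      exact ⟨C, fun t ht => hC t ht.1⟩
  -- the datum: `D¹u(0) ∈ L²`
  have h₀ : ∫⁻ x, ‖iteratedFDeriv ℝ 1 (u 0) x‖ₑ ^ 2 < ⊤ := by
    rw [lintegral_enorm_iteratedFDeriv_one_sq]
    exact lintegral_enorm_sq_lt_top_of_memLp_two hH1
  -- the energy in the `ℝ≥0` rendering
  have hE' : ∃ C : ℝ≥0, ∀ t ∈ Icc 0 T, ∫⁻ x, ‖u t x‖ₑ ^ 2 ≤ C := by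
    obtain ⟨C, hC, hb⟩ := hE
    exact ⟨C.toNNReal, fun t ht => by rw [ENNReal.coe_toNNReal hC.ne]; exact hb t ht⟩
  exact hsol.memSobolevX_one_forced_of_totalSpeed hν hT hf' h₀ hE'
    (hsol.dissipation_lt_top_of_clayForce hν hT hfs hfd hE)
    (hsol.totalSpeed_lt_top_of_clayForce hν hT hfs hfd hE)

/-- **The gradient of every slice is in `L²`** under the hypotheses of `memSobolevX_one_of_clayForce_H1`
(the `L^∞_t H¹_x` half of `X¹`; measurability from `u t ∈ C¹`). [cite: Tao2011, Cor. 11.1] -/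
theorem memLp_two_fderiv_slice_of_clayForce_H1 {ν T : ℝ} (hν : 0 < ν) (hT : 0 < T) {f u : ℝ → Vel}
    {p : ℝ → E3 → ℝ} (hsol : IsClassicalNSSolutionOn (Icc 0 T) ν f u p)
    (hfs : IsSmoothOnHalfSpace f) (hfd : HasRapidSpaceTimeDecay f)
    (hE : ∃ C : ℝ≥0∞, C < ⊤ ∧ ∀ t ∈ Icc 0 T, ∫⁻ x, ‖u t x‖ₑ ^ 2 ≤ C)
    (hH1 : MemLp (fderiv ℝ (u 0)) 2 volume) {t : ℝ} (ht : t ∈ Icc 0 T) :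
    MemLp (fderiv ℝ (u t)) 2 volume := by
  obtain ⟨C, hC⟩ := (memSobolevX_one_of_clayForce_H1 hν hT hsol hfs hfd hE hH1).1 1 le_rfl
  have hlt : ∫⁻ x, ‖fderiv ℝ (u t) x‖ₑ ^ 2 < ⊤ := by
    rw [← lintegral_enorm_iteratedFDeriv_one_sq]
    exact lt_of_le_of_lt (hC t ht) ENNReal.coe_lt_top
  have hC1 : ContDiff ℝ 1 (u t) := (hsol.contDiff_velocity (t := t) ht).of_le (by norm_cast)
  exact ⟨(hC1.continuous_fderiv one_ne_zero).aestronglyMeasurable,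
    eLpNorm_two_lt_top_of_lintegral_enorm_sq_lt_top hlt⟩

/-- **Every slice is in `L²`** from the finite-energy clause (measurability from continuity).
[folklore] -/
theorem memLp_two_slice_of_energy {ν T : ℝ} {f u : ℝ → Vel} {p : ℝ → E3 → ℝ}
    (hsol : IsClassicalNSSolutionOn (Icc 0 T) ν f u p)
    (hE : ∃ C : ℝ≥0∞, C < ⊤ ∧ ∀ t ∈ Icc 0 T, ∫⁻ x, ‖u t x‖ₑ ^ 2 ≤ C) {t : ℝ} (ht : t ∈ Icc 0 T) :
    MemLp (u t) 2 volume := by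
  obtain ⟨C, hC, hb⟩ := hE
  exact ⟨(hsol.contDiff_velocity (t := t) ht).continuous.aestronglyMeasurable,
    eLpNorm_two_lt_top_of_lintegral_enorm_sq_lt_top (lt_of_le_of_lt (hb t ht) hC)⟩

/-- **The v2 regularity class persists**: under the hypotheses of `memSobolevX_one_of_clayForce_H1`,
every slice `u t`, `t ∈ [0, T]`, is smooth, divergence free, `L²`, with `L²` gradient — exactly the
clause `TriggerSchemeH1.regular` asks of a level state. [cite: Tao2011, Cor. 11.1] -/
theorem regular_slice_of_clayForce_H1 {ν T : ℝ} (hν : 0 < ν) (hT : 0 < T) {f u : ℝ → Vel}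
    {p : ℝ → E3 → ℝ} (hsol : IsClassicalNSSolutionOn (Icc 0 T) ν f u p)
    (hfs : IsSmoothOnHalfSpace f) (hfd : HasRapidSpaceTimeDecay f)
    (hE : ∃ C : ℝ≥0∞, C < ⊤ ∧ ∀ t ∈ Icc 0 T, ∫⁻ x, ‖u t x‖ₑ ^ 2 ≤ C)
    (hH1 : MemLp (fderiv ℝ (u 0)) 2 volume) {t : ℝ} (ht : t ∈ Icc 0 T) :
    ContDiff ℝ ∞ (u t) ∧ NSWave0.IsDivFree (u t) ∧
      MemLp (u t) 2 volume ∧ MemLp (fderiv ℝ (u t)) 2 volume :=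
  ⟨hsol.contDiff_velocity (t := t) ht, fun x => hsol.divFree t ht x,
    memLp_two_slice_of_energy hsol hE ht,
    memLp_two_fderiv_slice_of_clayForce_H1 hν hT hsol hfs hfd hE hH1 ht⟩

/-! ## §3 Along a v2 link: every slice is a level-class field; the hand-over clause is pure design -/

namespace TriggerSchemeH1

variable {𝒮 : TriggerSchemeH1}

/-- The slab of a link has positive length: `0 < 2δ < T`, so `0 < T + δ`. [folklore] -/
theorem Link.slab_pos {ν U ε : ℝ} {w : Vel} (L : 𝒮.Link ν U ε w) : 0 < L.T + L.δ := by
  linarith [L.δ_pos, L.two_δ_lt]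

/-- **`H¹` PERSISTS ALONG A v2 STEP.** For a link at viscosity `ν > 0` from a member `w ∈ F U` of a
level `U ≥ U⋆` (so `w` is smooth, divergence free, `H¹` by `regular`), EVERY slice `L.u t`,
`t ∈ [0, T + δ]`, is smooth, divergence free, `L²` with `L²` gradient: the trigger is a Clay-class force
(`IsTrigger.clayForce`), the energy clause of the link is the finite-energy hypothesis, and Tao's
Cor. 11.1 with force does the rest (`regular_slice_of_clayForce_H1`). So the class `regular` of door
v2 is closed under the door's own dynamics — the kernel form of the ruling's «v2 adds no demand»;
v1's rapid-decay clause has no such persistence theorem. [cite: Tao2011, Cor. 11.1] -/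
theorem Link.regular_slice {ν U ε : ℝ} {w : Vel} (L : 𝒮.Link ν U ε w) (hν : 0 < ν)
    (hU : 𝒮.UStar ≤ U) (hw : w ∈ 𝒮.F U) {t : ℝ} (ht : t ∈ Icc 0 (L.T + L.δ)) :
    ContDiff ℝ ∞ (L.u t) ∧ NSWave0.IsDivFree (L.u t) ∧
      MemLp (L.u t) 2 volume ∧ MemLp (fderiv ℝ (L.u t)) 2 volume := by
  have hreg := 𝒮.regular U hU w hw
  have hH1 : MemLp (fderiv ℝ (L.u 0)) 2 volume := by rw [L.initial]; exact hreg.2.2.2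
  obtain ⟨hfs, hfd⟩ := L.trigger.clayForce
  exact regular_slice_of_clayForce_H1 hν L.slab_pos L.classical hfs hfd L.energy hH1 ht

/-- In particular the hand-over slice `L.u L.T` is a level-class field BY THE DYNAMICS ALONE (no use
of `w' ∈ F U'`; compare `Link.handover_regular`, which reads the same off the design membership).
[cite: Tao2011, Cor. 11.1] -/
theorem Link.regular_handover_of_dynamics {ν U ε : ℝ} {w : Vel} (L : 𝒮.Link ν U ε w) (hν : 0 < ν)
    (hU : 𝒮.UStar ≤ U) (hw : w ∈ 𝒮.F U) :
    ContDiff ℝ ∞ (L.u L.T) ∧ NSWave0.IsDivFree (L.u L.T) ∧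
      MemLp (L.u L.T) 2 volume ∧ MemLp (fderiv ℝ (L.u L.T)) 2 volume :=
  L.regular_slice hν hU hw ⟨by linarith [L.δ_pos, L.two_δ_lt], by linarith [L.δ_pos]⟩

/-- **The content of the hand-over clause is design membership.** Along a v2 link the unzoomed
hand-over slice `unzoom λ x₀ (L.u L.T)` IS the member `w'` (`unzoom_zoom`), so «`u T = zoom λ x₀ w'`
with `w' ∈ F U'`» says exactly: the unit-scale reading of the hand-over slice at centre `x₀` belongs
to the designed family one level up — regularity of that reading being automatic
(`Link.regular_handover_of_dynamics`, `regular` passes through `unzoom = zoom λ⁻¹ …` up to the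
harmless recentring). [folklore] -/
theorem Link.handover_content {ν U ε : ℝ} {w : Vel} (L : 𝒮.Link ν U ε w) :
    unzoom 𝒮.lam L.x₀ (L.u L.T) ∈ 𝒮.F L.U' := by
  rw [L.handover_eq_zoom, unzoom_zoom 𝒮.lam_pos.ne' L.x₀ L.w']
  exact L.mem

end TriggerSchemeH1

/-- **The same persistence for a v1 link**, through the embedding `TriggerScheme.toH1` (a v1 member
is rapidly decaying, hence `H¹`). [cite: Tao2011, Cor. 11.1] -/
theorem TriggerScheme.Link.regular_slice {𝒮 : TriggerScheme} {ν U ε : ℝ} {w : Vel}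
    (L : 𝒮.Link ν U ε w) (hν : 0 < ν) (hU : 𝒮.UStar ≤ U) (hw : w ∈ 𝒮.F U) {t : ℝ}
    (ht : t ∈ Icc 0 (L.T + L.δ)) :
    ContDiff ℝ ∞ (L.u t) ∧ NSWave0.IsDivFree (L.u t) ∧
      MemLp (L.u t) 2 volume ∧ MemLp (fderiv ℝ (L.u t)) 2 volume :=
  (TriggerScheme.Link.toH1 𝒮 L).regular_slice hν hU hw ht

end Summit.NavierStokesRegularity.FluidComputer.TriggeredTransfer

end
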